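import Mathlib.LinearAlgebra.Dimension.Finrank
import Mathlib.LinearAlgebra.FiniteDimensional.Defs
import Mathlib.LinearAlgebra.FiniteDimensional.Lemmas
import HarnessLib

/-!
# Route `SignedLowerHalves`, crux L `SmallImageLowerHalfBothSigns` (stmt-BirchSwinnertonDyer-23599), line `rtt_w3` v11 — row N of INJ
# (coordinate selection): from a finite family of linear maps on a finite-dimensional space that is JOINTLY injective one can select
# at most `dim V` of them that are still jointly injective (greedy on kernels).

LEAD `cruxlead-stmt-BirchSwinnertonDyer-23599` g6; helper `--supports stmt-BirchSwinnertonDyer-23599`; THEOREMS ONLY (generic linear algebra), no `sorry`;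
closes nothing; BSD / crux L / INJ are NOT proved by this file.

WHY (HELPER-TABLE v11 addendum 1, adopted glue route). The local splitting of the character module `M_θ|_{Γ_{K_v}} ≅ W[p^∞] ⊗_{𝒪_v} 𝒪` gives
`d = [F : K_v]` coordinate maps `s_j : M_θ → W_K[p^∞]`, jointly injective on `M_θ[π] ≅ k_S` (`k_v`-dimension `f/2`); INJ needs an injection of
`Sel_θ[π]` into `N` copies of B. D. Kim's group with `p^N ≤ #(𝒪/π) = p^f`, and each selected coordinate contributes two classes (`cor ξ_j`,
`cor([u]ξ_j)`). So exactly `≤ f/2` coordinates may be used, and they must stay jointly injective on `M_θ[π]`: this file's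
`exists_finset_card_le_finrank_forall_apply_eq_zero_imp`.

WHAT. `exists_subset_inf_ker_eq` — for submodules `K i` and a finset `S`: a sub-finset `J ⊆ S` with `J.inf K = S.inf K` and
`#J + dim (S.inf K) ≤ dim V` (induction on `S`: adding `a` either leaves the running intersection unchanged or drops its dimension);
`exists_finset_card_le_finrank_inf_ker_eq_bot` (`S = univ`, `⨅ = ⊥`); ★ `exists_finset_card_le_finrank_forall_apply_eq_zero_imp` (maps form).

References: [SerreLocalFields1979] I §4 (residue degrees; bookkeeping `N = 2·#J ≤ f`); linear algebra folklore (Steinitz exchange / greedy basis of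
the span of a family of functionals), e.g. [Bourbaki, Algèbre II §7 no. 5].
-/

set_option autoImplicit false
-- D-0017: single-problem summit, the namespace repeats the problem name by design.
set_option linter.dupNamespace false

universe u v w

namespace Summit.BirchSwinnertonDyer.BirchSwinnertonDyer.Theorems.SmallImageCharSignedSelmer

section Selection

variable {k : Type u} [DivisionRing k] {V : Type v} [AddCommGroup V] [Module k V] [FiniteDimensional k V] {ι : Type w}

/-- **Greedy selection on kernels.** For submodules `K i` (`i ∈ S`) of a finite-dimensional `V` there is `J ⊆ S` with the same intersection
and `#J + dim(⋂_{i∈S} K i) ≤ dim V`: by induction on `S`, a new index either contains the running intersection (skip it) or cuts its dimension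
by at least one (keep it). [cite: SerreLocalFields1979, I §4] -/
theorem exists_subset_inf_eq_card_add_finrank_le [DecidableEq ι] (K : ι → Submodule k V) (S : Finset ι) :
    ∃ J : Finset ι, J ⊆ S ∧ J.inf K = S.inf K ∧ J.card + Module.finrank k ↥(S.inf K) ≤ Module.finrank k V := by
  classical
  induction S using Finset.induction_on with
  | empty =>
    refine ⟨∅, Finset.Subset.refl _, rfl, ?_⟩
    rw [Finset.card_empty, zero_add, Finset.inf_empty, finrank_top]
  | @insert a S haS ih =>
    obtain ⟨J, hJS, hJinf, hJle⟩ := ih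
    by_cases hle : S.inf K ≤ K a
    · refine ⟨J, hJS.trans (Finset.subset_insert a S), ?_, ?_⟩
      · rw [Finset.inf_insert, hJinf, inf_eq_right.mpr hle]
      · rw [Finset.inf_insert, inf_eq_right.mpr hle]; exact hJle
    · have hlt : K a ⊓ S.inf K < S.inf K :=
        lt_of_le_of_ne inf_le_right fun h ↦ hle (h ▸ inf_le_left)
      have hdim : Module.finrank k ↥(K a ⊓ S.inf K) < Module.finrank k ↥(S.inf K) := Submodule.finrank_lt_finrank_of_lt hlt
      have haJ : a ∉ J := fun h ↦ haS (hJS h)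
      refine ⟨insert a J, Finset.insert_subset_insert a hJS, ?_, ?_⟩
      · rw [Finset.inf_insert, Finset.inf_insert, hJinf]
      · rw [Finset.card_insert_of_notMem haJ, Finset.inf_insert]
        omega

/-- **Selection, intersection form**: if `⋂_i K i = 0` over a finite index type then some `J` with `#J ≤ dim V` already has `⋂_{i∈J} K i = 0`.
[cite: SerreLocalFields1979, I §4] -/
theorem exists_finset_card_le_finrank_inf_eq_bot [Fintype ι] [DecidableEq ι] (K : ι → Submodule k V)
    (hK : (Finset.univ : Finset ι).inf K = ⊥) :
    ∃ J : Finset ι, J.card ≤ Module.finrank k V ∧ J.inf K = ⊥ := by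
  obtain ⟨J, -, hJinf, hJle⟩ := exists_subset_inf_eq_card_add_finrank_le K (Finset.univ : Finset ι)
  exact ⟨J, le_trans (Nat.le_add_right _ _) hJle, hJinf.trans hK⟩

/-- ★ **Selection, maps form (row N of INJ).** From a finite family of linear maps `f i : V → W i` on a finite-dimensional `V` that is JOINTLY
injective (`(∀ i, f i v = 0) → v = 0`) one can select `J` with `#J ≤ dim V` such that `(f i)_{i ∈ J}` is still jointly injective.
[cite: SerreLocalFields1979, I §4] -/
theorem exists_finset_card_le_finrank_forall_apply_eq_zero_imp [Fintype ι] {W : ι → Type*} [∀ i, AddCommGroup (W i)]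
    [∀ i, Module k (W i)] (f : ∀ i, V →ₗ[k] W i) (hf : ∀ v : V, (∀ i, f i v = 0) → v = 0) :
    ∃ J : Finset ι, J.card ≤ Module.finrank k V ∧ ∀ v : V, (∀ i ∈ J, f i v = 0) → v = 0 := by
  classical
  have hbot : (Finset.univ : Finset ι).inf (fun i ↦ LinearMap.ker (f i)) = ⊥ := by
    rw [eq_bot_iff]
    intro v hv
    rw [Submodule.mem_bot]
    refine hf v fun i ↦ ?_
    have hle : (Finset.univ : Finset ι).inf (fun i ↦ LinearMap.ker (f i)) ≤ LinearMap.ker (f i) :=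
      Finset.inf_le (f := fun i ↦ LinearMap.ker (f i)) (Finset.mem_univ i)
    exact LinearMap.mem_ker.mp (hle hv)
  obtain ⟨J, hJle, hJinf⟩ := exists_finset_card_le_finrank_inf_eq_bot (fun i ↦ LinearMap.ker (f i)) hbot
  refine ⟨J, hJle, fun v hv ↦ ?_⟩
  have hmem : v ∈ J.inf (fun i ↦ LinearMap.ker (f i)) := by
    refine (Finset.le_inf fun i hi ↦ ?_ : (k ∙ v) ≤ _) (Submodule.mem_span_singleton_self v)
    rw [Submodule.span_singleton_le_iff_mem, LinearMap.mem_ker]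
    exact hv i hi
  rw [hJinf, Submodule.mem_bot] at hmem
  exact hmem

end Selection

end Summit.BirchSwinnertonDyer.BirchSwinnertonDyer.Theorems.SmallImageCharSignedSelmer
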